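import Mathlib
import Summits.Ventures.PercRepro2.ThreeTermPartFibre

/-!
# Three-terminal parts, VI a: connectivity through the virtual triangle over a pinned background
(blind cell PercRepro2, night-3 g31, 2026-08-30; `proofs/NIGHT3-CERT.md` §40.7)

In the part graph `partEnds ends S e₁ e₂ e₃ t₁ t₂ t₃` the part's edges are the three VIRTUAL edges
`e₁ = {t₁,t₂}`, `e₂ = {t₁,t₃}`, `e₃ = {t₂,t₃}` (the others are loops).  For a configuration `x` whose
BACKGROUND `x₀ = setOn S (cfg 0) x` (every part edge closed) is fixed, connectivity in `x` is the
connectivity of `x₀` threaded through the open virtual edges: with the STEP relation on the terminals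
`PStep x x₀ a b := (a ≠ b ∧ x (ve a b) = true) ∨ Conn x₀ (tv a) (tv b)` and its three-point closure
`PRel` (a direct step, or two steps through the third terminal),

* **`conn_pattern_iff`**: `Conn x u v ↔ Conn x₀ u v ∨ ∃ a b, PRel x x₀ a b ∧ Conn x₀ u (tv a) ∧ Conn x₀ (tv b) v`
  — the cell's closure lemma `mem_of_conn_of_closed` on the set of vertices reachable by such a chain,
  every open edge of `x` being a background edge or a virtual edge.

This is the abstraction step of the pinned-core theorem (§40.5): the state of `x` on the marks depends
on `x₀` only through its connections among the eight points `a₁ a₂ o b a₃ t₁ t₂ t₃`.  Own work; standard axioms.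
-/

namespace Summit.Ventures.PercRepro2

open Block ThreeTerm TypedStar

namespace Part

section Closure

variable {V : Type*} {E : Type*} [DecidableEq E]

/-- The terminals as a function on `Fin 3`. -/
def tv (t₁ t₂ t₃ : V) : Fin 3 → V := ![t₁, t₂, t₃]

/-- The virtual edge joining two distinct terminals: `{0,1} ↦ e₁`, `{0,2} ↦ e₂`, `{1,2} ↦ e₃`. -/
def ve (e₁ e₂ e₃ : E) (a b : Fin 3) : E :=
  if (a = 0 ∧ b = 1) ∨ (a = 1 ∧ b = 0) then e₁
  else if (a = 0 ∧ b = 2) ∨ (a = 2 ∧ b = 0) then e₂ else e₃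

omit [DecidableEq E] in
/-- `ve` is symmetric. -/
lemma ve_symm (e₁ e₂ e₃ : E) (a b : Fin 3) : ve e₁ e₂ e₃ a b = ve e₁ e₂ e₃ b a := by
  fin_cases a <;> fin_cases b <;> simp [ve]

/-- The ends of a virtual edge are its terminals. -/
lemma partEnds_ve (ends : E → Sym2 V) (S : Finset E) {e₁ e₂ e₃ : E} (h12 : e₁ ≠ e₂) (h13 : e₁ ≠ e₃)
    (h23 : e₂ ≠ e₃) (t₁ t₂ t₃ : V) {a b : Fin 3} (hab : a ≠ b) :
    partEnds ends (↑S) e₁ e₂ e₃ t₁ t₂ t₃ (ve e₁ e₂ e₃ a b) = s(tv t₁ t₂ t₃ a, tv t₁ t₂ t₃ b) := by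
  fin_cases a <;> fin_cases b <;> simp [ve, tv] at hab ⊢
  · exact partEnds_apply_1 ends (↑S) t₁ t₂ t₃
  · exact partEnds_apply_2 ends (↑S) t₁ t₂ t₃ h12
  · rw [partEnds_apply_1 ends (↑S) t₁ t₂ t₃, Sym2.eq_swap]
  · exact partEnds_apply_3 ends (↑S) t₁ t₂ t₃ h13 h23
  · rw [partEnds_apply_2 ends (↑S) t₁ t₂ t₃ h12, Sym2.eq_swap]
  · rw [partEnds_apply_3 ends (↑S) t₁ t₂ t₃ h13 h23, Sym2.eq_swap]

/-- A step between two terminals: the virtual edge between them is open in `x`, or they are connected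
in the background `x₀`. -/
def PStep (ends : E → Sym2 V) (S : Finset E) (e₁ e₂ e₃ : E) (t₁ t₂ t₃ : V) (x x₀ : Config E)
    (a b : Fin 3) : Prop :=
  (a ≠ b ∧ x (ve e₁ e₂ e₃ a b) = true) ∨
    Conn (partEnds ends (↑S) e₁ e₂ e₃ t₁ t₂ t₃) x₀ (tv t₁ t₂ t₃ a) (tv t₁ t₂ t₃ b)

/-- The relation generated by the steps on three points: equal, a direct step, or two steps. -/
def PRel (ends : E → Sym2 V) (S : Finset E) (e₁ e₂ e₃ : E) (t₁ t₂ t₃ : V) (x x₀ : Config E)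
    (a b : Fin 3) : Prop :=
  a = b ∨ PStep ends S e₁ e₂ e₃ t₁ t₂ t₃ x x₀ a b ∨
    ∃ c, PStep ends S e₁ e₂ e₃ t₁ t₂ t₃ x x₀ a c ∧ PStep ends S e₁ e₂ e₃ t₁ t₂ t₃ x x₀ c b

variable (ends : E → Sym2 V) (S : Finset E) (e₁ e₂ e₃ : E) (t₁ t₂ t₃ : V) (x x₀ : Config E)

/-- Steps are symmetric. -/
lemma PStep.symm {a b : Fin 3} (h : PStep ends S e₁ e₂ e₃ t₁ t₂ t₃ x x₀ a b) :
    PStep ends S e₁ e₂ e₃ t₁ t₂ t₃ x x₀ b a := by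
  rcases h with ⟨hab, h⟩ | h
  · exact Or.inl ⟨hab.symm, by rwa [ve_symm]⟩
  · exact Or.inr (conn_symm h)

/-- `PRel` is symmetric. -/
lemma PRel.symm {a b : Fin 3} (h : PRel ends S e₁ e₂ e₃ t₁ t₂ t₃ x x₀ a b) :
    PRel ends S e₁ e₂ e₃ t₁ t₂ t₃ x x₀ b a := by
  rcases h with h | h | ⟨c, h1, h2⟩
  · exact Or.inl h.symm
  · exact Or.inr (Or.inl (PStep.symm ends S e₁ e₂ e₃ t₁ t₂ t₃ x x₀ h))
  · exact Or.inr (Or.inr ⟨c, PStep.symm ends S e₁ e₂ e₃ t₁ t₂ t₃ x x₀ h2,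
      PStep.symm ends S e₁ e₂ e₃ t₁ t₂ t₃ x x₀ h1⟩)

/-- A step followed by a relation is a relation (three points: the chain is direct or through the
third point). -/
lemma PRel.step_left {a b d : Fin 3} (hab : PStep ends S e₁ e₂ e₃ t₁ t₂ t₃ x x₀ a b)
    (hbd : PRel ends S e₁ e₂ e₃ t₁ t₂ t₃ x x₀ b d) : PRel ends S e₁ e₂ e₃ t₁ t₂ t₃ x x₀ a d := by
  rcases hbd with rfl | hbd | ⟨c, hbc, hcd⟩
  · exact Or.inr (Or.inl hab)
  · exact Or.inr (Or.inr ⟨b, hab, hbd⟩)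
  · -- a step a → b → c → d on three points
    by_cases had : a = d
    · exact Or.inl had
    by_cases hcd' : c = d
    · subst hcd'; exact Or.inr (Or.inr ⟨b, hab, hbc⟩)
    by_cases hbd' : b = d
    · subst hbd'; exact Or.inr (Or.inl hab)
    by_cases hbc' : b = c
    · subst hbc'; exact Or.inr (Or.inr ⟨b, hab, hcd⟩)
    by_cases hac : a = c
    · subst hac; exact Or.inr (Or.inl hcd)
    by_cases hab' : a = b
    · subst hab'; exact Or.inr (Or.inr ⟨c, hbc, hcd⟩)
    · exfalso
      have four : ∀ a b c d : Fin 3, ¬ (a ≠ b ∧ a ≠ c ∧ a ≠ d ∧ b ≠ c ∧ b ≠ d ∧ c ≠ d) := by decide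
      exact four a b c d ⟨hab', hac, had, hbc', hbd', hcd'⟩

/-- `PRel` is transitive. -/
lemma PRel.trans {a b d : Fin 3} (hab : PRel ends S e₁ e₂ e₃ t₁ t₂ t₃ x x₀ a b)
    (hbd : PRel ends S e₁ e₂ e₃ t₁ t₂ t₃ x x₀ b d) : PRel ends S e₁ e₂ e₃ t₁ t₂ t₃ x x₀ a d := by
  rcases hab with rfl | hab | ⟨c, hac, hcb⟩
  · exact hbd
  · exact PRel.step_left ends S e₁ e₂ e₃ t₁ t₂ t₃ x x₀ hab hbd
  · exact PRel.step_left ends S e₁ e₂ e₃ t₁ t₂ t₃ x x₀ hac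
      (PRel.step_left ends S e₁ e₂ e₃ t₁ t₂ t₃ x x₀ hcb hbd)

/-- A step gives a connection in `x` (the background lies below `x`). -/
lemma conn_of_PStep {e₁ e₂ e₃ : E} (h12 : e₁ ≠ e₂) (h13 : e₁ ≠ e₃) (h23 : e₂ ≠ e₃)
    {x x₀ : Config E} (hle : x₀ ≤ x) {a b : Fin 3}
    (h : PStep ends S e₁ e₂ e₃ t₁ t₂ t₃ x x₀ a b) :
    Conn (partEnds ends (↑S) e₁ e₂ e₃ t₁ t₂ t₃) x (tv t₁ t₂ t₃ a) (tv t₁ t₂ t₃ b) := by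
  rcases h with ⟨hab, h⟩ | h
  · exact conn_of_openAdj ⟨ve e₁ e₂ e₃ a b, h, partEnds_ve ends S h12 h13 h23 t₁ t₂ t₃ hab⟩
  · exact conn_mono hle h

/-- A relation gives a connection in `x`. -/
lemma conn_of_PRel {e₁ e₂ e₃ : E} (h12 : e₁ ≠ e₂) (h13 : e₁ ≠ e₃) (h23 : e₂ ≠ e₃)
    {x x₀ : Config E} (hle : x₀ ≤ x) {a b : Fin 3}
    (h : PRel ends S e₁ e₂ e₃ t₁ t₂ t₃ x x₀ a b) :
    Conn (partEnds ends (↑S) e₁ e₂ e₃ t₁ t₂ t₃) x (tv t₁ t₂ t₃ a) (tv t₁ t₂ t₃ b) := by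
  rcases h with rfl | h | ⟨c, h1, h2⟩
  · exact conn_refl _ _ _
  · exact conn_of_PStep ends S t₁ t₂ t₃ h12 h13 h23 hle h
  · exact conn_trans (conn_of_PStep ends S t₁ t₂ t₃ h12 h13 h23 hle h1)
      (conn_of_PStep ends S t₁ t₂ t₃ h12 h13 h23 hle h2)

/-- The background of `x`: every part edge closed. -/
lemma background_le (x : Config E) : setOn S (cfg e₁ e₂ e₃ 0) x ≤ x := by
  intro e
  by_cases he : e ∈ S
  · rw [setOn_of_mem he]
    have : cfg e₁ e₂ e₃ (0 : Fin 8) e = false := by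
      simp only [cfg]
      split_ifs <;> simp [bit]
    rw [this]; exact Bool.false_le _
  · rw [setOn_of_not_mem he]

/-- An open edge of `x` outside `S` is open in the background. -/
lemma background_eq_of_not_mem (x : Config E) {e : E} (he : e ∉ S) :
    setOn S (cfg e₁ e₂ e₃ 0) x e = x e := setOn_of_not_mem he _ _

/-- **CONNECTIVITY THROUGH THE VIRTUAL TRIANGLE**: in the part graph, `u` and `v` are connected in `x`
iff they are connected in the background `x₀ = setOn S (cfg 0) x`, or `u` reaches a terminal in the
background, the terminals are related by steps, and a terminal reaches `v` in the background. -/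
theorem conn_pattern_iff {e₁ e₂ e₃ : E} (h1 : e₁ ∈ S) (h2 : e₂ ∈ S) (h3 : e₃ ∈ S) (h12 : e₁ ≠ e₂)
    (h13 : e₁ ≠ e₃) (h23 : e₂ ≠ e₃) (x : Config E) (u v : V) :
    Conn (partEnds ends (↑S) e₁ e₂ e₃ t₁ t₂ t₃) x u v ↔
      Conn (partEnds ends (↑S) e₁ e₂ e₃ t₁ t₂ t₃) (setOn S (cfg e₁ e₂ e₃ 0) x) u v ∨
      ∃ a b : Fin 3, PRel ends S e₁ e₂ e₃ t₁ t₂ t₃ x (setOn S (cfg e₁ e₂ e₃ 0) x) a b ∧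
        Conn (partEnds ends (↑S) e₁ e₂ e₃ t₁ t₂ t₃) (setOn S (cfg e₁ e₂ e₃ 0) x) u (tv t₁ t₂ t₃ a) ∧
        Conn (partEnds ends (↑S) e₁ e₂ e₃ t₁ t₂ t₃) (setOn S (cfg e₁ e₂ e₃ 0) x) (tv t₁ t₂ t₃ b) v := by
  set G' := partEnds ends (↑S) e₁ e₂ e₃ t₁ t₂ t₃ with hG'
  set x₀ := setOn S (cfg e₁ e₂ e₃ 0) x with hx₀
  have hle : x₀ ≤ x := background_le S e₁ e₂ e₃ x
  constructor
  · intro h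
    -- the reachable set
    let X : Set V := {w | Conn G' x₀ u w ∨ ∃ a b : Fin 3, PRel ends S e₁ e₂ e₃ t₁ t₂ t₃ x x₀ a b ∧
      Conn G' x₀ u (tv t₁ t₂ t₃ a) ∧ Conn G' x₀ (tv t₁ t₂ t₃ b) w}
    have hu : u ∈ X := Or.inl (conn_refl _ _ _)
    refine mem_of_conn_of_closed (ends := G') (ω := x) (S := X) ?_ hu h
    intro w hw w' hadj
    rw [openGraph_adj] at hadj
    obtain ⟨hne, e, he, hends⟩ := hadj
    by_cases heS : e ∈ S
    · -- a part edge: a virtual edge (a loop cannot be an adjacency)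
      have hvirt : e = e₁ ∨ e = e₂ ∨ e = e₃ := by
        by_cases k1 : e = e₁
        · exact Or.inl k1
        by_cases k2 : e = e₂
        · exact Or.inr (Or.inl k2)
        by_cases k3 : e = e₃
        · exact Or.inr (Or.inr k3)
        exfalso
        rw [hG', partEnds_apply_of_mem ends (↑S) t₁ t₂ t₃ k1 k2 k3 heS, Sym2.eq_iff] at hends
        rcases hends with ⟨rfl, rfl⟩ | ⟨rfl, rfl⟩ <;> exact hne rfl
      -- the two terminals of the edge, as indices
      have key : ∃ a b : Fin 3, a ≠ b ∧ ve e₁ e₂ e₃ a b = e ∧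
          ((tv t₁ t₂ t₃ a = w ∧ tv t₁ t₂ t₃ b = w') ∨ (tv t₁ t₂ t₃ a = w' ∧ tv t₁ t₂ t₃ b = w)) := by
        rcases hvirt with rfl | rfl | rfl
        · rw [hG', partEnds_apply_1 ends (↑S) t₁ t₂ t₃, Sym2.eq_iff] at hends
          exact ⟨0, 1, by decide, by simp [ve], by simpa [tv] using hends⟩
        · rw [hG', partEnds_apply_2 ends (↑S) t₁ t₂ t₃ h12, Sym2.eq_iff] at hends
          exact ⟨0, 2, by decide, by simp [ve], by simpa [tv] using hends⟩
        · rw [hG', partEnds_apply_3 ends (↑S) t₁ t₂ t₃ h13 h23, Sym2.eq_iff] at hends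
          exact ⟨1, 2, by decide, by simp [ve], by simpa [tv] using hends⟩
      obtain ⟨a, b, hab, hve, hwab⟩ := key
      have hstep : PStep ends S e₁ e₂ e₃ t₁ t₂ t₃ x x₀ a b := Or.inl ⟨hab, by rw [hve]; exact he⟩
      -- normalise to w = tv a, w' = tv b (swap a b otherwise)
      have gen : ∀ a b : Fin 3, PStep ends S e₁ e₂ e₃ t₁ t₂ t₃ x x₀ a b →
          tv t₁ t₂ t₃ a ∈ X → tv t₁ t₂ t₃ b ∈ X := by
        intro a b hstep hwX
        rcases hwX with hwa | ⟨a', b', hrel, hua', hb'a⟩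
        · exact Or.inr ⟨a, b, Or.inr (Or.inl hstep), hwa, conn_refl _ _ _⟩
        · refine Or.inr ⟨a', b, ?_, hua', conn_refl _ _ _⟩
          exact PRel.trans ends S e₁ e₂ e₃ t₁ t₂ t₃ x x₀ hrel
            (PRel.trans ends S e₁ e₂ e₃ t₁ t₂ t₃ x x₀ (Or.inr (Or.inl (Or.inr hb'a)))
              (Or.inr (Or.inl hstep)))
      rcases hwab with ⟨hw1, hw2⟩ | ⟨hw1, hw2⟩
      · rw [← hw2]; exact gen a b hstep (hw1 ▸ hw)
      · rw [← hw1]; exact gen b a (PStep.symm ends S e₁ e₂ e₃ t₁ t₂ t₃ x x₀ hstep) (hw2 ▸ hw)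
    · -- a background edge
      have he₀ : x₀ e = true := by rw [hx₀, background_eq_of_not_mem S e₁ e₂ e₃ x heS]; exact he
      have hc : Conn G' x₀ w w' := conn_of_openAdj ⟨e, he₀, hends⟩
      rcases hw with hw | ⟨a, b, hrel, hua, hbw⟩
      · exact Or.inl (conn_trans hw hc)
      · exact Or.inr ⟨a, b, hrel, hua, conn_trans hbw hc⟩
  · rintro (h | ⟨a, b, hrel, hua, hbv⟩)
    · exact conn_mono hle h
    · exact conn_trans (conn_mono hle hua)
        (conn_trans (conn_of_PRel ends S t₁ t₂ t₃ h12 h13 h23 hle hrel) (conn_mono hle hbv))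

end Closure

end Part

end Summit.Ventures.PercRepro2
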